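import Literature.MathematicalPhysics.QuantumManyBody.PeriodicBoseGasJastrow
import HarnessLib

/-!
# Route `BECRichardsonGaudin`, crux `BeliaevDeformationBound` (stmt-AtomisticToContinuum-14804):
# the depletion of the Jastrow trial state (stub B1a of the line `registered`)

For a pair profile `φ` with cut-off `b`, `0 < 2b < L`, defect bound `∫(1 - φ²) ≤ I` with
`(N-1)I ≤ L³`, the normalised symmetric Jastrow state `Ψ_J = ∏_{i<j} Φ(xᵢ - xⱼ)/√ν`
(`IsPairProfile.trialState`) has condensate occupation `n₀(Ψ_J) ≥ N (1 - (N-1)I/L³)²`.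

The proof is the one-particle elimination of [LSSY2005, Thm. 2.2, proof, (2.22)–(2.26)] applied
to the one-body density matrix instead of the norm: with `Ψ_J(x, Y) = ν^{-1/2} Π₀(Y; x) Ψ'(Y)`
(`Π₀ = ∏_{j ≠ 0} Φ(x - xⱼ)`, `Ψ' = ∏_{0 < i < j} Φ(xᵢ - xⱼ)`), pointwise
`Π₀ ≥ 1 - ∑_{j ≠ 0} (1 - Φ(x - xⱼ)²)`, whence `∫_Ω Π₀(Y; x) dx ≥ L³ - (N-1)I` and
`|∫_Ω Ψ_J(x, Y) dx|² ≥ ν⁻¹ (L³ - (N-1)I)² Ψ'(Y)²`; integrating, `‖Ψ'‖² ≥ ‖Ψ‖² = ν` gives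
`n₀ = N L⁻⁶ ∫_{Ω^N} |∫_Ω Ψ_J(x, Y) dx|² dY ≥ N (1 - (N-1)I/L³)²`.

References: [LSSY2005] E. H. Lieb, R. Seiringer, J. P. Solovej, J. Yngvason, *The Mathematics of
the Bose Gas and its Condensation*, Birkhäuser 2005, Thm. 2.2, proof, (2.22)–(2.26);
[Fournais2020] S. Fournais, *Length scales for BEC in the dilute Bose gas*, (1.3)–(1.4).
-/

noncomputable section

namespace Summit.AtomisticToContinuum.BoseEinsteinCondensation.Theorems.BeliaevDeformationBound

open MeasureTheory Filter Literature.MathematicalPhysics.QuantumManyBody.BoseGas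
open scoped ENNReal

variable {N : ℕ} {L b : ℝ} {φ : Space → ℝ}

/-- Pointwise elimination for the slice product: `1 ≤ Π_k(X; x) + ∑_{l ≠ k} (1 - Φ(x - x_l)²)`
(from `1 ≤ ∏ t_l + ∑ (1 - t_l)` and `1 - t ≤ 1 - t²` on `[0, 1]`).
[cite: LSSY2005, Thm. 2.2, proof, (2.24)–(2.25)] -/
theorem jastrowDepletion_one_le_sliceProd_add (hφ : IsPairProfile b φ) (k : Fin N) (X : Config N)
    (x : Space) :
    1 ≤ sliceProd L φ k X x + ∑ l ∈ Finset.univ.erase k, (1 - pairFactor L φ (x - X l) ^ 2) := by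
  have h := one_le_prod_add_sum (Finset.univ.erase k) (fun l => pairFactor L φ (x - X l))
    (fun l _ => hφ.pairFactor_nonneg _) (fun l _ => hφ.pairFactor_le_one _)
  have h2 : ∑ l ∈ Finset.univ.erase k, (1 - pairFactor L φ (x - X l)) ≤
      ∑ l ∈ Finset.univ.erase k, (1 - pairFactor L φ (x - X l) ^ 2) :=
    Finset.sum_le_sum fun l _ => by
      have h0 := hφ.pairFactor_nonneg (L := L) (x - X l)
      have h1 := hφ.pairFactor_le_one (L := L) (x - X l)
      nlinarith
  unfold sliceProd
  linarith

/-- The same in `ℝ≥0∞`: `1 ≤ Π_k(X; x) + ∑_{l ≠ k} (1 - Φ(x - x_l)²)`.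
[cite: LSSY2005, Thm. 2.2, proof, (2.24)–(2.25)] -/
theorem jastrowDepletion_one_le_ofReal_sliceProd_add (hφ : IsPairProfile b φ) (k : Fin N)
    (X : Config N) (x : Space) :
    (1 : ℝ≥0∞) ≤ ENNReal.ofReal (sliceProd L φ k X x) +
      ∑ l ∈ Finset.univ.erase k, ENNReal.ofReal (1 - pairFactor L φ (x - X l) ^ 2) := by
  have hg : ∀ l, 0 ≤ 1 - pairFactor L φ (x - X l) ^ 2 := fun l => by
    have h0 := hφ.pairFactor_nonneg (L := L) (x - X l)
    have h1 := hφ.pairFactor_le_one (L := L) (x - X l)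
    nlinarith
  rw [← ENNReal.ofReal_one, ← ENNReal.ofReal_sum_of_nonneg fun l _ => hg l]
  exact (ENNReal.ofReal_le_ofReal (jastrowDepletion_one_le_sliceProd_add hφ k X x)).trans
    ENNReal.ofReal_add_le

/-- Integrated elimination for the slice product:
`L³ ≤ ∫_Ω Π_k(X; x) dx + |{l ≠ k}| · I` (`∫_Ω (1 - Φ(x - z)²) dx ≤ I`).
[cite: LSSY2005, Thm. 2.2, proof, (2.25)–(2.26)] -/
theorem jastrowDepletion_volume_le_lintegral_sliceProd_add (hφ : IsPairProfile b φ) (hL : 0 < L)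
    (hbL : 2 * b < L) (k : Fin N) (X : Config N) :
    ENNReal.ofReal L ^ 3 ≤ (∫⁻ x in cell L, ENNReal.ofReal (sliceProd L φ k X x)) +
      (Finset.univ.erase k).card * profileDefect φ := by
  have hmeas : ∀ l, Measurable fun x : Space =>
      ENNReal.ofReal (1 - pairFactor L φ (x - X l) ^ 2) := fun l =>
    (continuous_const.sub (((hφ.contDiff_pairFactor hL hbL).continuous.comp
      (continuous_id.sub continuous_const)).pow 2)).measurable.ennreal_ofReal
  calc ENNReal.ofReal L ^ 3 = ∫⁻ _ in cell L, (1 : ℝ≥0∞) := by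
        rw [setLIntegral_const, one_mul, volume_cell]
    _ ≤ ∫⁻ x in cell L, (ENNReal.ofReal (sliceProd L φ k X x) +
          ∑ l ∈ Finset.univ.erase k, ENNReal.ofReal (1 - pairFactor L φ (x - X l) ^ 2)) :=
        lintegral_mono fun x => jastrowDepletion_one_le_ofReal_sliceProd_add hφ k X x
    _ = (∫⁻ x in cell L, ENNReal.ofReal (sliceProd L φ k X x)) +
          ∑ l ∈ Finset.univ.erase k,
            ∫⁻ x in cell L, ENNReal.ofReal (1 - pairFactor L φ (x - X l) ^ 2) := by
        rw [lintegral_add_right _ (Finset.measurable_sum _ fun l _ => hmeas l),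
          lintegral_finsetSum _ fun l _ => hmeas l]
    _ ≤ (∫⁻ x in cell L, ENNReal.ofReal (sliceProd L φ k X x)) +
          ∑ l ∈ Finset.univ.erase k, profileDefect φ := by
        gcongr with l _
        exact hφ.lintegral_cell_defect_le hL (X l)
    _ = _ := by rw [Finset.sum_const, nsmul_eq_mul]

/-- `Π_k(X; ·)` is continuous. [folklore] -/
theorem jastrowDepletion_continuous_sliceProd (hφ : IsPairProfile b φ) (hL : 0 < L)
    (hbL : 2 * b < L) (k : Fin N) (X : Config N) : Continuous (sliceProd L φ k X) :=
  continuous_iff_continuousAt.mpr fun x => (hφ.hasFDerivAt_sliceProd hL hbL k X x).continuousAt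

/-- The box average of the `k`-th slice of the normalised Jastrow state `Ψ_J = Ψ/√ν`:
`|∫_Ω Ψ_J(…, x_k = x, …) dx| = ν^{-1/2} Ψ_{∖k}(X) ∫_Ω Π_k(X; x) dx` (slice factorisation
`Ψ(…, x_k = x, …) = Π_k(X; x) Ψ_{∖k}(X)`, everything non-negative).
[cite: LSSY2005, Thm. 2.2, proof, (2.19), (2.22)] -/
theorem jastrowDepletion_enorm_integral_slice (hφ : IsPairProfile b φ) (hL : 0 < L)
    (hbL : 2 * b < L) (hν : 0 < jastrowNormR L φ (Finset.univ : Finset (Fin N))) (k : Fin N)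
    (X : Config N) :
    (‖∫ x in cell L, (hφ.trialState hL hbL hν).ψ (Function.update X k x)‖₊ : ℝ≥0∞) =
      ENNReal.ofReal ((Real.sqrt (jastrowNormR L φ (Finset.univ : Finset (Fin N))))⁻¹ *
          jastrow L φ (Finset.univ.erase k) X) *
        ∫⁻ x in cell L, ENNReal.ofReal (sliceProd L φ k X x) := by
  set ν := jastrowNormR L φ (Finset.univ : Finset (Fin N))
  set c := (Real.sqrt ν)⁻¹ * jastrow L φ (Finset.univ.erase k) X with hc_def
  have hc0 : 0 ≤ c := mul_nonneg (inv_nonneg.mpr (Real.sqrt_nonneg _)) (hφ.jastrow_nonneg _ _)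
  have hF : ∀ x, (hφ.trialState hL hbL hν).ψ (Function.update X k x) =
      ((sliceProd L φ k X x * c : ℝ) : ℂ) := by
    intro x
    show ((jastrow L φ Finset.univ (Function.update X k x) * (Real.sqrt ν)⁻¹ : ℝ) : ℂ) = _
    rw [hφ.jastrow_update hL hbL.le, hc_def]
    push_cast
    ring
  simp_rw [hF]
  rw [integral_complex_ofReal, Complex.nnnorm_real]
  have hF0 : ∀ x, 0 ≤ sliceProd L φ k X x * c := fun x =>
    mul_nonneg (hφ.sliceProd_nonneg k X x) hc0
  have hFi : IntegrableOn (fun x => sliceProd L φ k X x * c) (cell L) volume := by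
    refine Measure.integrableOn_of_bounded (M := c) ?_ ?_ ?_
    · rw [volume_cell]; exact ENNReal.pow_ne_top ENNReal.ofReal_ne_top
    · exact ((jastrowDepletion_continuous_sliceProd hφ hL hbL k X).mul
        continuous_const).aestronglyMeasurable
    · exact ae_of_all _ fun x => by
        rw [Real.norm_of_nonneg (hF0 x)]
        exact mul_le_of_le_one_left hc0 (hφ.sliceProd_le_one k X x)
  rw [← enorm_eq_nnnorm, Real.enorm_eq_ofReal (integral_nonneg hF0),
    ofReal_integral_eq_lintegral_ofReal hFi (ae_of_all _ hF0)]
  simp_rw [ENNReal.ofReal_mul (hφ.sliceProd_nonneg k X _)]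
  rw [lintegral_mul_const' _ _ ENNReal.ofReal_ne_top, mul_comm]

/-- **Elimination in the one-body density matrix, pointwise**: for `(N-1)I ≤ L³`,
`|∫_Ω Ψ_J(…, x_k = x, …) dx|² ≥ ν⁻¹ (L³ - (N-1)I)² Ψ_{∖k}(X)²`.
[cite: LSSY2005, Thm. 2.2, proof, (2.22)–(2.26)] -/
theorem jastrowDepletion_slice_sq_ge (hφ : IsPairProfile b φ) (hL : 0 < L) (hbL : 2 * b < L)
    (hν : 0 < jastrowNormR L φ (Finset.univ : Finset (Fin N))) {I : ℝ} (hI0 : 0 ≤ I)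
    (hI : profileDefect φ ≤ ENNReal.ofReal I) (hNI : ((N : ℝ) - 1) * I ≤ L ^ 3) (k : Fin N)
    (X : Config N) :
    ENNReal.ofReal ((jastrowNormR L φ (Finset.univ : Finset (Fin N)))⁻¹ *
          (L ^ 3 - ((N : ℝ) - 1) * I) ^ 2) *
        ENNReal.ofReal (jastrow L φ (Finset.univ.erase k) X ^ 2) ≤
      (‖∫ x in cell L, (hφ.trialState hL hbL hν).ψ (Function.update X k x)‖₊ : ℝ≥0∞) ^ 2 := by
  set ν := jastrowNormR L φ (Finset.univ : Finset (Fin N))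
  set J := jastrow L φ (Finset.univ.erase k) X
  set D := L ^ 3 - ((N : ℝ) - 1) * I with hD_def
  have hD0 : 0 ≤ D := by rw [hD_def]; linarith
  have hJ0 : 0 ≤ J := hφ.jastrow_nonneg _ _
  have hs0 : 0 ≤ (Real.sqrt ν)⁻¹ := inv_nonneg.mpr (Real.sqrt_nonneg _)
  have hN1 : 0 ≤ (N : ℝ) - 1 := by
    have h1 : (1 : ℝ) ≤ N := by exact_mod_cast Fin.pos k
    linarith
  rw [jastrowDepletion_enorm_integral_slice hφ hL hbL hν k X]
  -- the lower bound for `∫_Ω Π_k`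
  have h1 : ENNReal.ofReal (L ^ 3 - ((N : ℝ) - 1) * I) ≤
      ∫⁻ x in cell L, ENNReal.ofReal (sliceProd L φ k X x) := by
    have h := jastrowDepletion_volume_le_lintegral_sliceProd_add hφ hL hbL k X
    have hcard : ((Finset.univ.erase k).card : ℝ≥0∞) = ENNReal.ofReal ((N : ℝ) - 1) := by
      rw [Finset.card_erase_of_mem (Finset.mem_univ k), Finset.card_univ, Fintype.card_fin,
        ← ENNReal.ofReal_natCast, Nat.cast_pred (Fin.pos k)]
    rw [hcard] at h
    have h2 : ENNReal.ofReal L ^ 3 ≤ (∫⁻ x in cell L, ENNReal.ofReal (sliceProd L φ k X x)) +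
        ENNReal.ofReal (((N : ℝ) - 1) * I) := by
      refine h.trans (add_le_add le_rfl ?_)
      rw [ENNReal.ofReal_mul hN1]
      exact mul_le_mul' le_rfl hI
    rw [ENNReal.ofReal_sub _ (mul_nonneg hN1 hI0), ENNReal.ofReal_pow hL.le]
    exact tsub_le_iff_right.mpr h2
  calc ENNReal.ofReal (ν⁻¹ * D ^ 2) * ENNReal.ofReal (J ^ 2)
      = (ENNReal.ofReal ((Real.sqrt ν)⁻¹ * J) * ENNReal.ofReal D) ^ 2 := by
        rw [mul_pow, ← ENNReal.ofReal_pow (mul_nonneg hs0 hJ0), ← ENNReal.ofReal_pow hD0,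
          ← ENNReal.ofReal_mul (sq_nonneg _),
          ← ENNReal.ofReal_mul (mul_nonneg (inv_nonneg.mpr hν.le) (sq_nonneg _))]
        congr 1
        rw [mul_pow, inv_pow, Real.sq_sqrt hν.le]
        ring
    _ ≤ (ENNReal.ofReal ((Real.sqrt ν)⁻¹ * J) *
          ∫⁻ x in cell L, ENNReal.ofReal (sliceProd L φ k X x)) ^ 2 := by
        gcongr

/-- **Elimination in the one-body density matrix, integrated**:
`∫_{Ω^N} |∫_Ω Ψ_J(…, x_k = x, …) dx|² dX ≥ (L³ - (N-1)I)²`, using `‖Ψ_{∖k}‖² ≥ ‖Ψ‖² = ν`.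
[cite: LSSY2005, Thm. 2.2, proof, (2.22)–(2.26)] -/
theorem jastrowDepletion_lintegral_slice_sq_ge (hφ : IsPairProfile b φ) (hL : 0 < L)
    (hbL : 2 * b < L) (hν : 0 < jastrowNormR L φ (Finset.univ : Finset (Fin N))) {I : ℝ}
    (hI0 : 0 ≤ I) (hI : profileDefect φ ≤ ENNReal.ofReal I) (hNI : ((N : ℝ) - 1) * I ≤ L ^ 3)
    (k : Fin N) :
    ENNReal.ofReal ((L ^ 3 - ((N : ℝ) - 1) * I) ^ 2) ≤
      ∫⁻ X in cellN N L,
        (‖∫ x in cell L, (hφ.trialState hL hbL hν).ψ (Function.update X k x)‖₊ : ℝ≥0∞) ^ 2 := by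
  set ν := jastrowNormR L φ (Finset.univ : Finset (Fin N))
  set c := ν⁻¹ * (L ^ 3 - ((N : ℝ) - 1) * I) ^ 2 with hc_def
  have hc0 : 0 ≤ c := mul_nonneg (inv_nonneg.mpr hν.le) (sq_nonneg _)
  calc ENNReal.ofReal ((L ^ 3 - ((N : ℝ) - 1) * I) ^ 2)
      = ENNReal.ofReal c * ENNReal.ofReal ν := by
        rw [← ENNReal.ofReal_mul hc0]
        congr 1
        rw [hc_def]
        field_simp
    _ = ENNReal.ofReal c * jastrowNormSq L φ (Finset.univ : Finset (Fin N)) := by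
        rw [hφ.ofReal_jastrowNormR]
    _ ≤ ENNReal.ofReal c * jastrowNormSq L φ (Finset.univ.erase k) := by
        gcongr
        refine lintegral_mono fun X => ENNReal.ofReal_le_ofReal ?_
        exact pow_le_pow_left₀ (hφ.jastrow_nonneg _ _)
          (hφ.prod_le_jastrow (pairsOf_mono (Finset.erase_subset k _)) X) 2
    _ = ∫⁻ X in cellN N L, ENNReal.ofReal c *
          ENNReal.ofReal (jastrow L φ (Finset.univ.erase k) X ^ 2) := by
        rw [lintegral_const_mul' _ _ ENNReal.ofReal_ne_top, jastrowNormSq]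
    _ ≤ _ := lintegral_mono fun X => jastrowDepletion_slice_sq_ge hφ hL hbL hν hI0 hI hNI k X

/-- **Depletion of the Jastrow trial state** (stub B1a of the line `registered` of the crux
`BeliaevDeformationBound`): for every pair profile `φ` with cut-off `b`, `0 < 2b < L`, defect
bound `∫(1 - φ²) ≤ I` with `(N-1)I ≤ L³`, the normalised Jastrow state
`Ψ_J = ∏_{i<j} Φ(xᵢ - xⱼ)/√ν` (`IsPairProfile.trialState`) has `n₀(Ψ_J) ≥ N (1 - (N-1)I/L³)²`.
One-particle elimination `∫_Ω Ψ_J(x, Y) dx ≥ ν^{-1/2} Ψ'(Y) (L³ - (N-1)I)` and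
`‖Ψ'‖² ≥ ‖Ψ‖²`, inserted in `n₀ = N L⁻⁶ ∫_{Ω^N} |∫_Ω Ψ_J(x, Y) dx|² dY`.
[cite: LSSY2005, Thm. 2.2, proof, (2.22)–(2.26)] -/
theorem stub_jastrowDepletion :
  ∀ (N : ℕ) (L b : ℝ) (φ : Space → ℝ) (hφ : IsPairProfile b φ) (hL : 0 < L) (hbL : 2 * b < L)
    (hν : 0 < jastrowNormR L φ (Finset.univ : Finset (Fin N))) (I : ℝ),
    0 ≤ I → profileDefect φ ≤ ENNReal.ofReal I → ((N : ℝ) - 1) * I ≤ L ^ 3 →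
    (N : ENNReal) * ENNReal.ofReal ((1 - ((N : ℝ) - 1) * I / L ^ 3) ^ 2) ≤
      condensateOccupation N L (hφ.trialState hL hbL hν).ψ := by
  intro N L b φ hφ hL hbL hν I hI0 hI hNI
  cases N with
  | zero => simp [condensateOccupation, occupation]
  | succ n =>
    have hB := jastrowDepletion_lintegral_slice_sq_ge hφ hL hbL hν hI0 hI hNI 0
    rw [lintegral_sliceMeanSq_zero L (hφ.trialState hL hbL hν).contDiff.continuous] at hB
    rw [condensateOccupation_succ hL]
    set A := ∫⁻ Y in cellN n L, (‖∫ x in cell L,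
      (hφ.trialState hL hbL hν).ψ (Matrix.vecCons x Y)‖₊ : ℝ≥0∞) ^ 2
    set D := L ^ 3 - (((n + 1 : ℕ) : ℝ) - 1) * I with hD_def
    have hL3 : ENNReal.ofReal L ^ 3 ≠ 0 := pow_ne_zero _ (by simpa using hL)
    have hL3' : ENNReal.ofReal L ^ 3 ≠ ⊤ := ENNReal.pow_ne_top ENNReal.ofReal_ne_top
    have hL3r : (0 : ℝ) < L ^ 3 := by positivity
    have hkey : ENNReal.ofReal ((1 - (((n + 1 : ℕ) : ℝ) - 1) * I / L ^ 3) ^ 2) ≤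
        (ENNReal.ofReal L ^ 3)⁻¹ * A := by
      have heq : (1 - (((n + 1 : ℕ) : ℝ) - 1) * I / L ^ 3) ^ 2 =
          (L ^ 3)⁻¹ * ((L ^ 3)⁻¹ * D ^ 2) := by
        rw [hD_def]
        field_simp
      rw [heq, ENNReal.ofReal_mul (by positivity), ENNReal.ofReal_mul (by positivity),
        ENNReal.ofReal_inv_of_pos hL3r, ENNReal.ofReal_pow hL.le]
      gcongr
      calc (ENNReal.ofReal L ^ 3)⁻¹ * ENNReal.ofReal (D ^ 2)
          ≤ (ENNReal.ofReal L ^ 3)⁻¹ * (ENNReal.ofReal L ^ 3 * A) := by gcongr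
        _ = A := by rw [← mul_assoc, ENNReal.inv_mul_cancel hL3 hL3', one_mul]
    calc ((n + 1 : ℕ) : ℝ≥0∞) * ENNReal.ofReal ((1 - (((n + 1 : ℕ) : ℝ) - 1) * I / L ^ 3) ^ 2)
        ≤ ((n + 1 : ℕ) : ℝ≥0∞) * ((ENNReal.ofReal L ^ 3)⁻¹ * A) := by gcongr
      _ = _ := by push_cast; rfl

end Summit.AtomisticToContinuum.BoseEinsteinCondensation.Theorems.BeliaevDeformationBound

end
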